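import Mathlib
import HarnessLib
import Summits.QuantumFields.YangMills.Theses.PencilRigidity
/-!
# `CurvatureKernelBound` — stub H `HalfSpaceKernel`, generic lemmas: weak cluster vectors along an ultrafilter, equicontinuity, norms of weak limits

(support for stmt-QuantumFields-11687, line `sixteen-charts-analytic-kernel`, skeleton v11)
-/

noncomputable section

open scoped BigOperators Topology SchwartzMap ComplexConjugate InnerProductSpace
open MeasureTheory Filter Set Metric
open Literature.MathematicalPhysics.QuantumLattice Literature.MathematicalPhysics.AQFT
open Literature.MathematicalPhysics.QuantumFieldTheory

namespace Summit.QuantumFields.YangMills.Theorems.CurvatureKernel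
/-! ## A. Generic Hilbert-space and analysis lemmas -/

/-- **Weak cluster vector along an ultrafilter**: a norm-bounded sequence in a Hilbert space has a
vector `Ψ` towards which it converges weakly along any ultrafilter (bounded scalar sequences converge
along ultrafilters; the limit functional is bounded; Riesz representation). [folklore] -/
theorem exists_weak_cluster_vector {H : Type*} [NormedAddCommGroup H] [InnerProductSpace ℂ H]
    [CompleteSpace H] (𝒰 : Ultrafilter ℕ) (w : ℕ → H) (R : ℝ) (hw : ∀ n, ‖w n‖ ≤ R) :
    ∃ Ψ : H, ‖Ψ‖ ≤ R ∧ ∀ Φ : H, Tendsto (fun n => ⟪Φ, w n⟫_ℂ) (↑𝒰 : Filter ℕ) (𝓝 ⟪Φ, Ψ⟫_ℂ) := by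
  -- adapted from `Literature.Analysis.FunctionSpaces.exists_weak_limit_ultrafilter`
  -- (`WightmanSpacelikeClustering`): scalar limits along `𝒰`, then Riesz representation.
  have hR : 0 ≤ R := (norm_nonneg _).trans (hw 0)
  -- every bounded scalar sequence converges along the ultrafilter (compact closed discs)
  have hscalar : ∀ (c : ℕ → ℂ) (C : ℝ), (∀ n, ‖c n‖ ≤ C) →
      ∃ x : ℂ, ‖x‖ ≤ C ∧ Tendsto c (↑𝒰 : Filter ℕ) (𝓝 x) := fun c C hc => by
    have hle : (↑(Ultrafilter.map c 𝒰) : Filter ℂ) ≤ 𝓟 (closedBall (0 : ℂ) C) := by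
      rw [Ultrafilter.coe_map, le_principal_iff]
      exact mem_map.2 (Eventually.of_forall fun n => mem_closedBall_zero_iff.2 (hc n))
    obtain ⟨x, hx, hxle⟩ := (isCompact_closedBall (0 : ℂ) C).ultrafilter_le_nhds _ hle
    rw [Ultrafilter.coe_map] at hxle
    exact ⟨x, mem_closedBall_zero_iff.1 hx, hxle⟩
  have hlim : ∀ Φ : H, ∃ x : ℂ, ‖x‖ ≤ R * ‖Φ‖ ∧
      Tendsto (fun n => ⟪Φ, w n⟫_ℂ) (↑𝒰 : Filter ℕ) (𝓝 x) := fun Φ =>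
    hscalar _ _ fun n =>
      (norm_inner_le_norm Φ (w n)).trans
        (by rw [mul_comm]; exact mul_le_mul_of_nonneg_right (hw n) (norm_nonneg Φ))
  choose ℓ hℓb hℓ using hlim
  -- the limit functional is conjugate-linear and bounded by `R`
  have hadd : ∀ Φ Φ' : H, ℓ (Φ + Φ') = ℓ Φ + ℓ Φ' := fun Φ Φ' =>
    tendsto_nhds_unique (hℓ (Φ + Φ'))
      (by simpa only [inner_add_left] using (hℓ Φ).add (hℓ Φ'))
  have hsmul : ∀ (c : ℂ) (Φ : H), ℓ (c • Φ) = conj c * ℓ Φ := fun c Φ =>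
    tendsto_nhds_unique (hℓ (c • Φ))
      (by simpa only [inner_smul_left] using (hℓ Φ).const_mul (conj c))
  let L₀ : H →ₗ[ℂ] ℂ :=
    { toFun := fun Φ => conj (ℓ Φ)
      map_add' := fun Φ Φ' => by simp only [hadd, map_add]
      map_smul' := fun c Φ => by
        simp only [hsmul, map_mul, starRingEnd_self_apply, RingHom.id_apply, smul_eq_mul] }
  let L : H →L[ℂ] ℂ := L₀.mkContinuous R fun Φ => by
    simp only [L₀, LinearMap.coe_mk, AddHom.coe_mk, RCLike.norm_conj]
    exact hℓb Φ
  -- Riesz representation of `L`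
  refine ⟨(InnerProductSpace.toDual ℂ H).symm L, ?_, fun Φ => ?_⟩
  · rw [LinearIsometryEquiv.norm_map]
    exact L₀.mkContinuous_norm_le hR _
  · have h2 : ⟪Φ, (InnerProductSpace.toDual ℂ H).symm L⟫_ℂ = ℓ Φ := by
      rw [← inner_conj_symm, InnerProductSpace.toDual_symm_apply]
      simp only [L, LinearMap.mkContinuous_apply, L₀, LinearMap.coe_mk, AddHom.coe_mk,
        starRingEnd_self_apply]
    rw [h2]
    exact hℓ Φ

/-- **Equicontinuity upgrades pointwise convergence along a filter to uniform convergence on a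
compact set.** [folklore] -/
theorem tendstoUniformlyOn_of_equicontinuous {X : Type*} [PseudoMetricSpace X] {l : Filter ℕ}
    {S : Set X} (hS : IsCompact S) (g : ℕ → X → ℂ) (g' : X → ℂ)
    (hpt : ∀ x ∈ S, Tendsto (fun n => g n x) l (𝓝 (g' x)))
    (heq : ∀ ε > 0, ∃ δ > 0, ∀ n, ∀ x ∈ S, ∀ y ∈ S, dist x y < δ → dist (g n x) (g n y) ≤ ε) :
    ∀ ε > 0, ∀ᶠ n in l, ∀ x ∈ S, dist (g n x) (g' x) ≤ ε := by
  intro ε hε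
  rcases l.eq_or_neBot with rfl | hl
  · exact eventually_bot
  obtain ⟨δ, hδ, hδeq⟩ := heq (ε / 3) (by positivity)
  -- the limit function inherits the modulus of continuity on `S`
  have hg' : ∀ x ∈ S, ∀ y ∈ S, dist x y < δ → dist (g' x) (g' y) ≤ ε / 3 :=
    fun x hx y hy hxy =>
      le_of_tendsto ((hpt x hx).dist (hpt y hy))
        (Eventually.of_forall fun n => hδeq n x hx y hy hxy)
  -- a finite `δ`-net of the compact set `S`, centred in `S`
  obtain ⟨t, htS, htfin, hcover⟩ := finite_cover_balls_of_compact hS hδ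
  have hcent : ∀ᶠ n in l, ∀ c ∈ t, dist (g n c) (g' c) < ε / 3 :=
    htfin.eventually_all.2 fun c hc => Metric.tendsto_nhds.1 (hpt c (htS hc)) _ (by positivity)
  filter_upwards [hcent] with n hn x hx
  obtain ⟨c, hc, hxc⟩ := Set.mem_iUnion₂.1 (hcover hx)
  have hxc' : dist x c < δ := mem_ball.1 hxc
  calc dist (g n x) (g' x)
        ≤ dist (g n x) (g n c) + dist (g n c) (g' c) + dist (g' c) (g' x) :=
          dist_triangle4 _ _ _ _
    _ ≤ ε / 3 + ε / 3 + ε / 3 := by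
        gcongr
        · exact hδeq n x hx c (htS hc) hxc'
        · exact (hn c hc).le
        · exact hg' c (htS hc) x hx (by rw [dist_comm]; exact hxc')
    _ = ε := by ring

/-! ## G. Auxiliary: from an eventual bound to a uniform bound; norm of a weak limit -/

/-- A sequence bounded eventually `atTop` is bounded. [folklore] -/
theorem exists_forall_norm_le_of_eventually {H : Type*} [NormedAddCommGroup H] (w : ℕ → H) {R : ℝ}
    (hR : 0 ≤ R) (hw : ∀ᶠ n in atTop, ‖w n‖ ≤ R) : ∃ C : ℝ, ∀ n, ‖w n‖ ≤ C := by
  obtain ⟨n₀, hn₀⟩ := eventually_atTop.1 hw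
  refine ⟨R + ∑ k ∈ Finset.range n₀, ‖w k‖, fun n => ?_⟩
  by_cases hn : n₀ ≤ n
  · exact (hn₀ n hn).trans (le_add_of_nonneg_right (Finset.sum_nonneg fun _ _ => norm_nonneg _))
  · have hmem : n ∈ Finset.range n₀ := Finset.mem_range.2 (lt_of_not_ge hn)
    have := Finset.single_le_sum (f := fun k => ‖w k‖) (fun _ _ => norm_nonneg _) hmem
    linarith

/-- **The norm of a weak limit** is bounded by an eventual bound on the norms. [folklore] -/
theorem norm_le_of_tendsto_inner {H : Type*} [NormedAddCommGroup H] [InnerProductSpace ℂ H] {l : Filter ℕ} [l.NeBot]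
    {w : ℕ → H} {Ψ : H} (hΨ : ∀ Φ : H, Tendsto (fun n => ⟪Φ, w n⟫_ℂ) l (𝓝 ⟪Φ, Ψ⟫_ℂ)) {R : ℝ} (hR : 0 ≤ R)
    (hw : ∀ᶠ n in l, ‖w n‖ ≤ R) : ‖Ψ‖ ≤ R := by
  -- `‖Ψ‖² = ‖⟪Ψ, Ψ⟫‖ = lim ‖⟪Ψ, w n⟫‖ ≤ ‖Ψ‖ R`
  have h1 : ‖⟪Ψ, Ψ⟫_ℂ‖ ≤ ‖Ψ‖ * R :=
    le_of_tendsto (hΨ Ψ).norm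
      (hw.mono fun n hn => (norm_inner_le_norm Ψ (w n)).trans (by gcongr))
  have h2 : ‖⟪Ψ, Ψ⟫_ℂ‖ = ‖Ψ‖ * ‖Ψ‖ := by
    rw [inner_self_eq_norm_sq_to_K, norm_pow, RCLike.norm_ofReal, abs_norm, pow_two]
  rw [h2] at h1
  by_cases h0 : ‖Ψ‖ = 0
  · rw [h0]; exact hR
  · exact le_of_mul_le_mul_left h1 (lt_of_le_of_ne (norm_nonneg _) (Ne.symm h0))


/-- **Sub-goal `WeakClusterVector`** (helper for stub `HalfSpaceKernel`; registered signature): a norm-bounded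
sequence in a complex Hilbert space has, along any ultrafilter on `ℕ`, a weak cluster vector of no larger norm.
[folklore] -/
theorem WeakClusterVector : ∀ {H : Type*} [NormedAddCommGroup H] [InnerProductSpace ℂ H] [CompleteSpace H] (𝒰 : Ultrafilter ℕ) (w : ℕ → H) (R : ℝ), (∀ n, ‖w n‖ ≤ R) → ∃ Ψ : H, ‖Ψ‖ ≤ R ∧ ∀ Φ : H, Filter.Tendsto (fun n => inner ℂ Φ (w n)) (↑𝒰 : Filter ℕ) (nhds (inner ℂ Φ Ψ)) := by
  intro H _ _ _ 𝒰 w R hw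
  exact exists_weak_cluster_vector 𝒰 w R hw

end Summit.QuantumFields.YangMills.Theorems.CurvatureKernel

end
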